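import Mathlib
import Literature.Computability.Cryptography.Harvey2021
import HarnessLib

/-!
# Harvey 2021: the `o(1)` bridge for machine bounds with polynomial overhead in the bit length

Continuing `Harvey2021.lean` (`harvey_factoring_one_fifth_of_time_bound`: a factoring machine
with `time n ≤ C · (2^{n/5} n^{16/5} + 1)` witnesses **pqc.S09**,
`Literature.Computability.Cryptography.harvey_factoring_one_fifth`).  A verified machine for
Harvey's Theorem 1.1 in Mathlib's `TM2` model will not reproduce the printed `log^{16/5} N`:
schoolbook integer arithmetic, the stack-machine data movement and the simulation overheads each
cost further powers of `n = log₂ N`.  All of these are absorbed by the `o(1)` in the exponent;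
this file records that once and for all:

* `succ_le_const_mul_two_rpow`, `pow_succ_le_const_mul_two_rpow` — `(n+1)^c ≤ C_{c,ε} · 2^{εn}`
  (polynomial versus exponential, from `1 + x ≤ eˣ`);
* **`harvey_factoring_one_fifth_of_time_bound_poly`** — any `TM2` machine computing
  `Nat.primeFactorsList` with `time n ≤ C · 2^{n/5} · (n+1)^c` for some constants `C, c`
  witnesses `harvey_factoring_one_fifth` (with `C_ε = |C| · C_{c,ε}`).

## References

* D. Harvey, *An exponent one-fifth algorithm for deterministic integer factorisation*,
  Math. Comp. 90 (2021) 2937–2950, Thm 1.1 (arXiv:2010.05450, Thm 1). [Harvey2021]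
-/

open Real

namespace Literature.Computability.Cryptography

open Turing _root_.Computability

namespace Harvey2021

/-- **Linear versus exponential**: `n + 1 ≤ (1/(δ log 2) + 1) · 2^{δn}` for `δ > 0`, from
`1 + x ≤ eˣ`. [folklore] -/
theorem succ_le_const_mul_two_rpow {δ : ℝ} (hδ : 0 < δ) (n : ℕ) :
    (n : ℝ) + 1 ≤ (1 / (δ * Real.log 2) + 1) * (2 : ℝ) ^ (δ * n) := by
  have hlog : 0 < Real.log 2 := Real.log_pos one_lt_two
  have hpos : 0 < δ * Real.log 2 := mul_pos hδ hlog
  have h2 : (2 : ℝ) ^ (δ * n) = Real.exp (δ * n * Real.log 2) := by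
    rw [Real.rpow_def_of_pos two_pos]; congr 1; ring
  have hexp : δ * n * Real.log 2 + 1 ≤ (2 : ℝ) ^ (δ * n) := by
    rw [h2]; exact Real.add_one_le_exp _
  have hone : 1 ≤ (2 : ℝ) ^ (δ * n) := Real.one_le_rpow one_le_two (by positivity)
  have hn : (n : ℝ) ≤ (2 : ℝ) ^ (δ * n) / (δ * Real.log 2) := by
    rw [le_div_iff₀ hpos]
    have : (n : ℝ) * (δ * Real.log 2) = δ * n * Real.log 2 := by ring
    rw [this]; linarith
  calc (n : ℝ) + 1 ≤ (2 : ℝ) ^ (δ * n) / (δ * Real.log 2) + (2 : ℝ) ^ (δ * n) :=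
        add_le_add hn hone
    _ = (1 / (δ * Real.log 2) + 1) * (2 : ℝ) ^ (δ * n) := by ring

/-- **Polynomial versus exponential**: for every `c` and `ε > 0` there is `C > 0` with
`(n+1)^c ≤ C · 2^{εn}` for all `n`. [folklore] -/
theorem pow_succ_le_const_mul_two_rpow : ∀ (c : ℕ) {ε : ℝ}, 0 < ε →
    ∃ C : ℝ, 0 < C ∧ ∀ n : ℕ, ((n : ℝ) + 1) ^ c ≤ C * (2 : ℝ) ^ (ε * n)
  | 0, ε, _ => ⟨1, one_pos, fun n => by
      rw [pow_zero, one_mul]; exact Real.one_le_rpow one_le_two (by positivity)⟩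
  | c + 1, ε, hε => by
    have hlog : 0 < Real.log 2 := Real.log_pos one_lt_two
    obtain ⟨C, hC, h⟩ := pow_succ_le_const_mul_two_rpow c (half_pos hε)
    refine ⟨C * (1 / (ε / 2 * Real.log 2) + 1), by positivity, fun n => ?_⟩
    have h1 := h n
    have h2 := succ_le_const_mul_two_rpow (half_pos hε) n
    have hsplit : (2 : ℝ) ^ (ε * n) = (2 : ℝ) ^ (ε / 2 * n) * (2 : ℝ) ^ (ε / 2 * n) := by
      rw [← Real.rpow_add two_pos]; congr 1; ring
    rw [pow_succ, hsplit]
    calc ((n : ℝ) + 1) ^ c * ((n : ℝ) + 1)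
        ≤ (C * (2 : ℝ) ^ (ε / 2 * n)) * ((1 / (ε / 2 * Real.log 2) + 1) * (2 : ℝ) ^ (ε / 2 * n)) :=
          mul_le_mul h1 h2 (by positivity) (by positivity)
      _ = C * (1 / (ε / 2 * Real.log 2) + 1) * ((2 : ℝ) ^ (ε / 2 * n) * (2 : ℝ) ^ (ε / 2 * n)) := by
          ring

/-- **The `o(1)` bridge with polynomial overhead** (bookkeeping from a machine bound to
**pqc.S09**): a `TM2` machine computing `Nat.primeFactorsList` (binary in, `encodeListNat` out)
whose running time on inputs of bit length `n` is at most `C · 2^{n/5} · (n+1)^c` — the shape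
of Harvey's `O(N^{1/5} log^{16/5} N)` (Thm 1.1) after any polynomial-in-`log N` losses of a
formal machine model — witnesses `harvey_factoring_one_fifth`, with `C_ε = |C| · C_{c,ε}` from
`pow_succ_le_const_mul_two_rpow`. [cite: Harvey2021, Thm 1.1 (arXiv Thm 1)] -/
theorem harvey_factoring_one_fifth_of_time_bound_poly
    (M : TM2ComputableInTime encodeNat encodeListNat Nat.primeFactorsList) (C : ℝ) (c : ℕ)
    (hC : ∀ n : ℕ, (M.time n : ℝ) ≤ C * ((2 : ℝ) ^ ((n : ℝ) / 5) * ((n : ℝ) + 1) ^ c)) :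
    harvey_factoring_one_fifth := by
  refine ⟨M, fun ε hε => ?_⟩
  obtain ⟨K, hK, hKn⟩ := pow_succ_le_const_mul_two_rpow c hε
  refine ⟨|C| * K, fun n => ?_⟩
  have hexp : (n : ℝ) / 5 + ε * n = (1 / 5 + ε) * n := by ring
  have h1 : (2 : ℝ) ^ ((n : ℝ) / 5) * ((n : ℝ) + 1) ^ c ≤ K * (2 : ℝ) ^ ((1 / 5 + ε) * n) := by
    calc (2 : ℝ) ^ ((n : ℝ) / 5) * ((n : ℝ) + 1) ^ c
        ≤ (2 : ℝ) ^ ((n : ℝ) / 5) * (K * (2 : ℝ) ^ (ε * n)) :=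
          mul_le_mul_of_nonneg_left (hKn n) (by positivity)
      _ = K * ((2 : ℝ) ^ ((n : ℝ) / 5) * (2 : ℝ) ^ (ε * n)) := by ring
      _ = K * (2 : ℝ) ^ ((1 / 5 + ε) * n) := by rw [← Real.rpow_add two_pos, hexp]
  calc (M.time n : ℝ) ≤ C * (2 ^ ((n : ℝ) / 5) * ((n : ℝ) + 1) ^ c) := hC n
    _ ≤ |C| * (2 ^ ((n : ℝ) / 5) * ((n : ℝ) + 1) ^ c) :=
        mul_le_mul_of_nonneg_right (le_abs_self C) (by positivity)
    _ ≤ |C| * (K * 2 ^ ((1 / 5 + ε) * n)) := mul_le_mul_of_nonneg_left h1 (abs_nonneg C)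
    _ = |C| * K * 2 ^ ((1 / 5 + ε) * n) := by ring

end Harvey2021

end Literature.Computability.Cryptography
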